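import Summits.CriticalPhenomena.Ising3DConformalLimit.Theses.FKParityRobustness
import Summits.CriticalPhenomena.Ising3DConformalLimit.Theorems.FKParityRobustnessStrandsJoinBound
import Summits.CriticalPhenomena.Ising3DConformalLimit.Theorems.FKParityRobustnessLatticeBoundFromStrands
import Summits.CriticalPhenomena.Ising3DConformalLimit.Theorems.FKParityRobustnessShadowGivesJoin
import Summits.CriticalPhenomena.Ising3DConformalLimit.Theorems.FKParityRobustnessDefs
import HarnessLib

/-!
# Crux `IndependentStrandsJoin` (stmt-CriticalPhenomena-14625), line `Sketch` — stub `stub_converse`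

Helper file for the crux skeleton `Cruxes/IndependentStrandsJoin/Lines/Sketch.lean` (lead
`prover-line-stmt-CriticalPhenomena-14625-0`); proves exactly the registered stub `stub_converse`
(`--supports stmt-CriticalPhenomena-14625`): the CONVERSE direction of the tetrahedral sandwich,

  `IndependentStrandsJoin → TetraU4Lattice`,

i.e. the crux (two independent critical sourced loop-O(1) configurations in the free box `Λ_N ⊂ ℤ³` join the
tetrahedron `l · tetra` across with `ℓ ⊗ ℓ`-weight `≥ c · Z^{a₀a₁} Z^{a₂a₃}`) implies the lattice clause (iii)
at tetrahedra: `U₄^{Λ_N}(l·tetra) ≤ −2c · ⟨σ_{a₀}σ_{a₁}⟩_{Λ_N} ⟨σ_{a₂}σ_{a₃}⟩_{Λ_N}` at `β_c`, with the SAME `N₀(l)`.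
Together with the line's transfer (`stub_transfer`: `TetraU4Lattice` with constant `c` ⟹ crux with `c/3`) the
crux and `TetraU4Lattice` are ONE statement up to constants — the remaining stub `stub_tetraU4Lattice` of the
skeleton IS the crux in spin dress.

Proof: `StrandsJoinBound` (item 14647, PROVED: `strandsJoinBound_proof`, Aizenman's identity + the odd-part
law, `U₄ (Z⁰)² ≤ −2 · jointSum`) and the finite-graph algebra `defect_of_join` (divide by `(Z⁰)² > 0`,
`⟨σ_xσ_y⟩^free = Z^{xy}/Z⁰`), then `twoPoint = isingCorr` on the pair (`twoPoint_eq_loopO1_div`,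
`isingCorr_univ_free_eq_loopO1_div`).  The same argument is the standing disprover's `tetraU4Lattice_of_crux`
(`Cruxes/IndependentStrandsJoin/Disproof.lean` § B, with `StrandsJoinBound` as a hypothesis); here it is
discharged by the landed `strandsJoinBound_proof`.

References: M. Aizenman, Comm. Math. Phys. 86 (1982), Prop. 5.3 [AizenmanCMP1982]; M. Aizenman,
H. Duminil-Copin, Ann. of Math. 194 (2021), eq. (3.11) [AizenmanDuminilCopinAnnals2021].
-/

noncomputable section

open Finset SimpleGraph
open Literature.Probability.LatticeModels
open Summit.CriticalPhenomena.Ising3DConformalLimit.Theses.FKParityRobustness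
open Summit.CriticalPhenomena.Ising3DConformalLimit.FKParityRobustnessStrandsJoinBound (strandsJoinBound_proof)
open Summit.CriticalPhenomena.Ising3DConformalLimit.FKParityRobustnessLatticeBoundFromStrands
  (defect_of_join twoPoint_eq_loopO1_div)
open Summit.CriticalPhenomena.Ising3DConformalLimit.Cruxes.ParityRobustMerging.PlaquetteXorSurgery
  (tetra tetra_injective tanh_criticalBeta_nonneg)

namespace Summit.CriticalPhenomena.Ising3DConformalLimit.Theorems

open scoped Classical BigOperators

/-- **Stub `stub_converse` (crux ⟹ `TetraU4Lattice`, constant `2c`, same `N₀`).**  If two independent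
critical sourced loop-O(1) configurations in the free box join `l · tetra` across with weight
`≥ c · Z^{a₀a₁} · Z^{a₂a₃}` (the crux `IndependentStrandsJoin`), then the free critical Ising measure of the
induced box graph has `U₄(a) ≤ −2c · ⟨σ_{a₀}σ_{a₁}⟩ · ⟨σ_{a₂}σ_{a₃}⟩` for `a = l · tetra`, `l ≥ 1`, `N ≥ N₀(l)`:
`StrandsJoinBound` (`strandsJoinBound_proof`) + `defect_of_join` + `⟨σ_xσ_y⟩ = Z^{xy}/Z⁰`. -/
theorem stub_converse :
    IndependentStrandsJoin →
    ∃ c : ℝ, 0 < c ∧ ∀ l : ℕ, 1 ≤ l → ∃ N₀ : ℕ, ∀ N : ℕ, N₀ ≤ N → ∀ a : Fin 4 → ↥(box 3 N),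
      (∀ i, ((a i : Site 3)) = (l : ℤ) •
        (![![-1, -1, -1], ![1, 1, -1], ![1, -1, 1], ![-1, 1, 1]] : Fin 4 → Site 3) i) →
      connectedFour (isingMeasure ((zdGraph 3).comap (Subtype.val : ↥(box 3 N) → Site 3))
          Finset.univ (criticalBeta 3) 0 .free) spinAt a
        ≤ -(c * isingCorr ((zdGraph 3).comap (Subtype.val : ↥(box 3 N) → Site 3)) Finset.univ
              (criticalBeta 3) 0 .free {a 0, a 1} *
            isingCorr ((zdGraph 3).comap (Subtype.val : ↥(box 3 N) → Site 3)) Finset.univ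
              (criticalBeta 3) 0 .free {a 2, a 3}) := by
  rintro ⟨c, hc, h⟩
  refine ⟨2 * c, by positivity, fun l hl => ?_⟩
  obtain ⟨N₀, hN⟩ := h l hl
  refine ⟨N₀, fun N hNN a ha => ?_⟩
  have hcrux := hN N hNN a ha
  simp only at hcrux
  set G := (zdGraph 3).comap (Subtype.val : ↥(box 3 N) → Site 3) with hG
  have hinj : Function.Injective a := tetra_injective hl a (fun i => by rw [ha i]; rfl)
  have hβ : 0 ≤ criticalBeta 3 := criticalBeta_nonneg 3
  have hS := strandsJoinBound_proof (↥(box 3 N)) G (criticalBeta 3) hβ a hinj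
  simp only at hS
  have hU := defect_of_join G hβ a hinj hcrux hS
  rw [twoPoint_eq_loopO1_div hβ (hinj.ne (by decide)), twoPoint_eq_loopO1_div hβ (hinj.ne (by decide)),
    ← isingCorr_univ_free_eq_loopO1_div, ← isingCorr_univ_free_eq_loopO1_div] at hU
  linarith [hU]

end Summit.CriticalPhenomena.Ising3DConformalLimit.Theorems

end
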